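import Mathlib
import Literature.MathematicalPhysics.QuantumFieldTheory.Balaban1983to89.B13PerturbativeStep

/-!
# `Summit.QuantumFields.BalabanUV.Beta.UnitLatticeWalkInversion` — the SPINE of a generalized random-walk
# expansion for the inverse of `1 + K′` on a unit lattice: the partition-of-unity RESUMMATION IDENTITY
# `(1 + K′)·Σ_□ H_□L_□H_□ = 1 − R`, `R = Σ_□ [H_□, K′] L_□ H_□`, the bound `WRS(R) ≤ (2N/M)·C_L·K₁` (the first
# exponential moment `K₁` of `K′`, the Lipschitz constant `1/M` of the partition, the overlap `N`, the local-inverse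
# budget `C_L`), the inverse `(1 + K′)⁻¹ = (Σ_□ H_□L_□H_□)(1 − R)⁻¹` in the weighted-row-sum algebra, and the walk
# expansion to every order with a geometric remainder

HONEST FRAMING (page 1 of everything in this cell).  Discharging `FlowStep.BetaPertH` would make
Bałaban's ultraviolet stability UNCONDITIONAL — a constructive-QFT result; it is NOT the continuum
limit and NOT the Clay problem.  This module discharges nothing of `BetaPertH`; [folklore] finite-dimensional
algebra (the parametrix ∕ resolvent resummation behind every «generalized random walk expansion»: Glimm–Jaffe,
Bałaban [B4 Sect. 5, B6 §2, B9 Sects. C–D]; IMS-type localisation), kernel-checked; unit `b2b-balaban-beta-d4-p3`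
(row D4 co-owner #3, road P3 «reduction road», gen 3), kernel leaf A3-spine of the road's re-cut of NODE A =
(T1)(i)(ii) ⇐ (T2) G-IF-10 ⇐ (T3) G-B9-10 (skeleton `beta/skeletons/D4-b2b-balaban-beta-d4-p3.md` v1.5 §7).
HONEST DEPENDENCY: continuum YM on T⁴ ⇐ BetaPertH ∧ nine spine estimates (0/9 proved); BetaPertH ⇐
(D1) ∧ (D4) ∧ CAP+tail; G-an2-4 gates asym, D1 and NE2/3/4.

WHY THIS FILE.  The row-D4 owner's `OUTLINE-D4-NODE-A.md` (an4-g36) records for (T2) = G-IF-10 («G̃₃(x) has the same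
properties as G̃₂», [II] = B13 (CMP 116) p. 13 ∕ B10 (CMP 102) p. 272) a second route A.3′: Woodbury to the UNIT
lattice reduces the x-vertex of G̃₃(x) to the unit-lattice resolvent `(I + xK)⁻¹`, `K = Q̂G₂Q̂*` with exponentially
decaying kernel, `x ∈ [0, 2γ₁]` NOT small; «DECAY is Combes–Thomas and is in the tree … LOCALIZATION in U needs K's
own walk structure threaded through a resolvent expansion — not printed for this K».  This module is the resolvent
expansion's spine, abstract over a finite index set `Y` with a pseudo-metric `d` (the cell's `B13PerturbativeStep.WRS`
algebra BY NAME), for an ARBITRARY kernel `K′` (read `K′ = xK`: every bound below is linear in the data of `K′`, so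
uniform on the compact x-range):
* §1 objects: the partition matrices `H_□ = diag(h_□)` (real `h_□`, `Σ_□ h_□² = 1`, `supp h_□ ⊆ □̃`, `|h_□| ≤ 1`,
  `|h_□(y) − h_□(y′)| ≤ d(y,y′)/M`), the cube projections `P_□ = diag(1_{□̃})`, LOCAL INVERSES `L_□` as hypothesis-objects
  («`P_□(1 + K′)P_□ · L_□ = P_□`, `P_□L_□ = L_□`» — their construction from accretivity + decay is the sibling
  `AccretiveCombesThomas(Budget)`'s business), the parametrix `Ptot = Σ_□ H_□L_□H_□` and the remainder
  `R = Σ_□ (H_□K′ − K′H_□)L_□H_□`;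
* §2 `resummation_identity : (1 + K′) * Ptot = 1 − R` (pure algebra: `[1 + K′, H_□] = [K′, H_□]`, `H_□ = H_□P_□`);
* §3 bounds in the weighted-row-sum algebra: `wrs_Ptot` (`WRS κ d Ptot (N·C_L)`), `wrs_Rem`
  (`WRS κ d R ((2N/M)·C_L·K₁)` with `K₁ ≥ Σ_j ‖K′(i,j)‖ d(i,j) e^{κd(i,j)}` — the commutator gains the Lipschitz factor
  `d/M`, the local inverse is paid by `C_L`, the overlap by `2N`);
* §4 `isUnit_one_add`, `inv_one_add_eq` (`(1 + K′)⁻¹ = Ptot·(1 − R)⁻¹`), `wrs_inv_one_add`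
  (`WRS κ d (1 + K′)⁻¹ (N·C_L·(1 − ρ)⁻¹)` once `(2N/M)·C_L·K₁ ≤ ρ < 1`, i.e. for `M` LARGE at fixed `x ≤ X` — «M
  sufficiently large» is where the x-uniformity is paid), and the WALK EXPANSION TO EVERY ORDER
  `inv_one_add_eq_sum` : `(1 + K′)⁻¹ = Σ_{n<m} Ptot·Rⁿ + Ptot·R^m·(1 − R)⁻¹` with `WRS(Ptot·R^m·(1 − R)⁻¹) ≤ N C_L ρ^m∕(1−ρ)`:
  the terms `Ptot·Rⁿ` are sums over sequences of cubes of products of LOCAL factors `H_□`, `L_□`, `[H_□, K′]`.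
WHAT IS NOT HERE (next leaf A3-refinement): the U-LOCALISATION of the local inverses themselves (near∕far splitting
`L_□ = L_□^{near}Σ_m(−K′^{far}L_□^{near})^m` when `K′` is itself a walk series), the s-decoration bookkeeping in an4's
`termSum`∕`monoTerm` vocabulary, and any instance (which `K`, which cubes): records the mechanism, bounds nothing of
Bałaban's.

ABSOLUTE RULE.  Nothing printed is cited as a fact; nothing of other lineages restated (BY NAME: `WRS`, `wrs`,
`WeightHyp`, `wrs_mul_le`, `WRS.mul`, `WRS.pow`, `isUnit_one_sub`, `WRS.inv_one_sub`, `inv_one_sub_eq` of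
`B13PerturbativeStep`).  NOT summit progress.
-/

open scoped BigOperators Matrix
open Finset Matrix

namespace Summit.QuantumFields.BalabanUV.Beta.UnitLatticeWalkInversion

open Literature.MathematicalPhysics.QuantumFieldTheory.Balaban1983to89.B13PerturbativeStep

noncomputable section

variable {Y : Type*} [Fintype Y] [DecidableEq Y] {B : Type*}

/-! ## §1 Objects -/

/-- The partition matrix `H_□ = diag(h_□)` of a real partition function, as a complex matrix. [folklore] -/
def Hd (h : B → Y → ℝ) (b : B) : Matrix Y Y ℂ := Matrix.diagonal fun y => ((h b y : ℝ) : ℂ)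

/-- The cube projection `P_□ = diag(1_{□̃})`. [folklore] -/
def Pj (E : B → Finset Y) (b : B) : Matrix Y Y ℂ := Matrix.diagonal fun y => if y ∈ E b then (1 : ℂ) else 0

/-- The PARAMETRIX `Ptot = Σ_□ H_□ L_□ H_□`. [folklore] -/
def Ptot [Fintype B] (h : B → Y → ℝ) (L : B → Matrix Y Y ℂ) : Matrix Y Y ℂ := ∑ b, Hd h b * L b * Hd h b

/-- The REMAINDER `R = Σ_□ (H_□K′ − K′H_□) L_□ H_□` (one commutator per term). [folklore] -/
def Rem [Fintype B] (h : B → Y → ℝ) (K' : Matrix Y Y ℂ) (L : B → Matrix Y Y ℂ) : Matrix Y Y ℂ :=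
  ∑ b, (Hd h b * K' - K' * Hd h b) * L b * Hd h b

/-- Entries of `H_□`-sandwiches: `(H_□ A H_□)(i,j) = h_□(i) A(i,j) h_□(j)`. [folklore] -/
theorem Hd_mul_mul_Hd_apply (h : B → Y → ℝ) (b : B) (A : Matrix Y Y ℂ) (i j : Y) :
    (Hd h b * A * Hd h b) i j = (h b i : ℂ) * A i j * (h b j : ℂ) := by
  simp [Hd, Matrix.mul_diagonal, Matrix.diagonal_mul, mul_assoc]

/-- Entries of the commutator: `(H_□K′ − K′H_□)(i,j) = (h_□(i) − h_□(j)) K′(i,j)`. [folklore] -/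
theorem comm_apply (h : B → Y → ℝ) (b : B) (K' : Matrix Y Y ℂ) (i j : Y) :
    (Hd h b * K' - K' * Hd h b) i j = ((h b i : ℂ) - (h b j : ℂ)) * K' i j := by
  simp only [Hd, Matrix.sub_apply, Matrix.mul_diagonal, Matrix.diagonal_mul]
  ring

/-- `H_□ = H_□ P_□` when `supp h_□ ⊆ □̃`. [folklore] -/
theorem Hd_mul_Pj (h : B → Y → ℝ) (E : B → Finset Y) (hsupp : ∀ b y, y ∉ E b → h b y = 0) (b : B) :
    Hd h b * Pj E b = Hd h b := by
  rw [Hd, Pj, Matrix.diagonal_mul_diagonal]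
  congr 1
  funext y
  by_cases hy : y ∈ E b
  · simp [hy]
  · simp [hy, hsupp b y hy]

/-- `Σ_□ H_□² = 1` when `Σ_□ h_□² = 1` pointwise. [folklore] -/
theorem sum_Hd_mul_Hd [Fintype B] (h : B → Y → ℝ) (hsum : ∀ y, ∑ b, h b y ^ 2 = 1) :
    ∑ b, Hd h b * Hd h b = 1 := by
  have hb : ∀ b, Hd h b * Hd h b = Matrix.diagonal fun y => (((h b y) ^ 2 : ℝ) : ℂ) := fun b => by
    rw [Hd, Matrix.diagonal_mul_diagonal]
    congr 1; funext y; push_cast; ring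
  simp_rw [hb]
  ext i j
  rw [Matrix.sum_apply, Matrix.one_apply]
  simp only [Matrix.diagonal_apply]
  split_ifs with hij
  · subst hij
    exact_mod_cast hsum i
  · simp

/-! ## §2 The resummation identity -/

/-- One cube: `(1 + K′)·(H L H) = H² + (K′H − HK′) L H` when `P(1 + K′)P·L = P` and `PL = L` (local inverse on □̃)
and `HP = H` (support). [folklore] -/
theorem one_add_mul_local (K' H P L : Matrix Y Y ℂ) (hHP : H * P = H) (hPL : P * L = L)
    (hinv : P * (1 + K') * P * L = P) :
    (1 + K') * (H * L * H) = H * H + (K' * H - H * K') * L * H := by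
  -- (1 + K′)H = H(1 + K′) + (K′H − HK′)
  have hcomm : (1 + K') * H = H * (1 + K') + (K' * H - H * K') := by noncomm_ring
  -- H(1 + K′)L H = H P (1 + K′) P L H = H P H = H H
  have hmid : H * (1 + K') * L * H = H * H := by
    calc H * (1 + K') * L * H = (H * P) * (1 + K') * (P * L) * H := by rw [hHP, hPL]
      _ = H * (P * (1 + K') * P * L) * H := by noncomm_ring
      _ = H * P * H := by rw [hinv]
      _ = H * H := by rw [hHP]
  calc (1 + K') * (H * L * H) = ((1 + K') * H) * L * H := by noncomm_ring
    _ = (H * (1 + K') + (K' * H - H * K')) * L * H := by rw [hcomm]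
    _ = H * (1 + K') * L * H + (K' * H - H * K') * L * H := by noncomm_ring
    _ = H * H + (K' * H - H * K') * L * H := by rw [hmid]

/-- **THE RESUMMATION IDENTITY** `(1 + K′)·Ptot = 1 − R`: summing `one_add_mul_local` over the cubes with
`Σ_□ H_□² = 1`. [folklore] -/
theorem resummation_identity [Fintype B] (K' : Matrix Y Y ℂ) (h : B → Y → ℝ) (E : B → Finset Y)
    (L : B → Matrix Y Y ℂ) (hsum : ∀ y, ∑ b, h b y ^ 2 = 1) (hsupp : ∀ b y, y ∉ E b → h b y = 0)
    (hPL : ∀ b, Pj E b * L b = L b) (hinv : ∀ b, Pj E b * (1 + K') * Pj E b * L b = Pj E b) :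
    (1 + K') * Ptot h L = 1 - Rem h K' L := by
  unfold Ptot Rem
  rw [Finset.mul_sum]
  have hterm : ∀ b, (1 + K') * (Hd h b * L b * Hd h b)
      = Hd h b * Hd h b + (K' * Hd h b - Hd h b * K') * L b * Hd h b :=
    fun b => one_add_mul_local K' (Hd h b) (Pj E b) (L b) (Hd_mul_Pj h E hsupp b) (hPL b) (hinv b)
  simp_rw [hterm]
  rw [Finset.sum_add_distrib, sum_Hd_mul_Hd h hsum, sub_eq_add_neg, ← Finset.sum_neg_distrib]
  congr 1
  refine Finset.sum_congr rfl fun b _ => ?_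
  noncomm_ring

/-! ## §3 Bounds in the weighted-row-sum algebra -/

section Bounds

variable {κ : ℝ} {d : Y → Y → ℝ}

omit [DecidableEq Y] in
/-- `wrs` of a finite sum of matrices is at most the sum of the `wrs`. [folklore] -/
theorem wrs_sum_le {ι : Type*} (s : Finset ι) (A : ι → Matrix Y Y ℂ) (i : Y) :
    wrs κ d (∑ c ∈ s, A c) i ≤ ∑ c ∈ s, wrs κ d (A c) i := by
  classical
  induction s using Finset.induction_on with
  | empty => simp [wrs]
  | insert a s ha ih =>
      rw [Finset.sum_insert ha, Finset.sum_insert ha]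
      exact (wrs_add_le _ _ _).trans (add_le_add le_rfl ih)

/-- `wrs (H_□ A H_□) i ≤ |h_□(i)|·wrs A i` when `|h_□| ≤ 1`. [folklore] -/
theorem wrs_Hd_mul_mul_Hd_le (h : B → Y → ℝ) (habs : ∀ b y, |h b y| ≤ 1) (b : B) (A : Matrix Y Y ℂ) (i : Y) :
    wrs κ d (Hd h b * A * Hd h b) i ≤ |h b i| * wrs κ d A i := by
  unfold wrs
  rw [Finset.mul_sum]
  refine Finset.sum_le_sum fun j _ => ?_
  rw [Hd_mul_mul_Hd_apply, norm_mul, norm_mul, Complex.norm_real, Complex.norm_real, Real.norm_eq_abs,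
    Real.norm_eq_abs]
  have h1 : |h b j| ≤ 1 := habs b j
  have h0 : 0 ≤ |h b i| * ‖A i j‖ * Real.exp (κ * d i j) := by positivity
  nlinarith [abs_nonneg (h b j), norm_nonneg (A i j), Real.exp_pos (κ * d i j), abs_nonneg (h b i)]

omit [Fintype Y] in
/-- `Σ_□ |h_□(i)| ≤ #{□ : i ∈ □̃}` (each `|h_□| ≤ 1`, and `h_□(i) = 0` unless `i ∈ □̃`). [folklore] -/
theorem sum_abs_h_le [Fintype B] (h : B → Y → ℝ) (E : B → Finset Y) (hsupp : ∀ b y, y ∉ E b → h b y = 0)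
    (habs : ∀ b y, |h b y| ≤ 1) (i : Y) :
    ∑ b, |h b i| ≤ ((Finset.univ.filter fun b => i ∈ E b).card : ℝ) := by
  classical
  rw [← Finset.sum_filter_add_sum_filter_not Finset.univ (fun b => i ∈ E b) (fun b => |h b i|)]
  have h0 : ∑ b ∈ Finset.univ.filter (fun b => ¬ i ∈ E b), |h b i| = 0 :=
    Finset.sum_eq_zero fun b hb => by
      rw [Finset.mem_filter] at hb
      simp [hsupp b i hb.2]
  rw [h0, add_zero]
  calc ∑ b ∈ Finset.univ.filter (fun b => i ∈ E b), |h b i|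
      ≤ ∑ b ∈ Finset.univ.filter (fun b => i ∈ E b), (1 : ℝ) := Finset.sum_le_sum fun b _ => habs b i
    _ = ((Finset.univ.filter fun b => i ∈ E b).card : ℝ) := by simp

omit [Fintype Y] in
/-- The LIPSCHITZ–OVERLAP count: `Σ_□ |h_□(i) − h_□(j)| ≤ 2N·d(i,j)/M` (only cubes whose `□̃` contains `i` or `j`
contribute, at most `2N` of them, each by the Lipschitz bound). [folklore] -/
theorem sum_abs_h_sub_le [Fintype B] (h : B → Y → ℝ) (E : B → Finset Y) (hsupp : ∀ b y, y ∉ E b → h b y = 0)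
    {M N : ℝ} (hM : 0 < M) (hLip : ∀ b y y', |h b y - h b y'| ≤ d y y' / M) (hd : ∀ y y', 0 ≤ d y y')
    (hN : ∀ y, ((Finset.univ.filter fun b => y ∈ E b).card : ℝ) ≤ N) (i j : Y) :
    ∑ b, |h b i - h b j| ≤ 2 * N * d i j / M := by
  classical
  set S := Finset.univ.filter fun b => i ∈ E b ∨ j ∈ E b with hS
  rw [← Finset.sum_filter_add_sum_filter_not Finset.univ (fun b => i ∈ E b ∨ j ∈ E b) (fun b => |h b i - h b j|)]
  have h0 : ∑ b ∈ Finset.univ.filter (fun b => ¬ (i ∈ E b ∨ j ∈ E b)), |h b i - h b j| = 0 :=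
    Finset.sum_eq_zero fun b hb => by
      rw [Finset.mem_filter] at hb
      push Not at hb
      simp [hsupp b i hb.2.1, hsupp b j hb.2.2]
  rw [h0, add_zero]
  have hcard : (S.card : ℝ) ≤ 2 * N := by
    have hsub : S = (Finset.univ.filter fun b => i ∈ E b) ∪ (Finset.univ.filter fun b => j ∈ E b) := by
      rw [hS, Finset.filter_or]
    have := Finset.card_union_le (Finset.univ.filter fun b => i ∈ E b) (Finset.univ.filter fun b => j ∈ E b)
    rw [← hsub] at this
    have h2 : (S.card : ℝ) ≤ ((Finset.univ.filter fun b => i ∈ E b).card : ℝ)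
        + ((Finset.univ.filter fun b => j ∈ E b).card : ℝ) := by exact_mod_cast this
    linarith [hN i, hN j]
  have hdM : 0 ≤ d i j / M := div_nonneg (hd i j) hM.le
  calc ∑ b ∈ S, |h b i - h b j| ≤ ∑ b ∈ S, d i j / M := Finset.sum_le_sum fun b _ => hLip b i j
    _ = (S.card : ℝ) * (d i j / M) := by simp
    _ ≤ 2 * N * (d i j / M) := mul_le_mul_of_nonneg_right hcard hdM
    _ = 2 * N * d i j / M := by ring

/-- **Parametrix bound** `WRS κ d Ptot (N·C_L)`: at row `i` only the `≤ N` cubes with `i ∈ □̃` contribute, each at most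
`C_L`. [folklore] -/
theorem wrs_Ptot [Fintype B] (h : B → Y → ℝ) (E : B → Finset Y) (L : B → Matrix Y Y ℂ)
    (hsupp : ∀ b y, y ∉ E b → h b y = 0) (habs : ∀ b y, |h b y| ≤ 1) {N C_L : ℝ} (hC : 0 ≤ C_L)
    (hN : ∀ y, ((Finset.univ.filter fun b => y ∈ E b).card : ℝ) ≤ N) (hL : ∀ b, WRS κ d (L b) C_L) :
    WRS κ d (Ptot h L) (N * C_L) := by
  intro i
  calc wrs κ d (Ptot h L) i ≤ ∑ b, wrs κ d (Hd h b * L b * Hd h b) i := wrs_sum_le _ _ i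
    _ ≤ ∑ b, |h b i| * C_L := Finset.sum_le_sum fun b _ =>
        (wrs_Hd_mul_mul_Hd_le h habs b (L b) i).trans (mul_le_mul_of_nonneg_left (hL b i) (abs_nonneg _))
    _ = (∑ b, |h b i|) * C_L := by rw [Finset.sum_mul]
    _ ≤ N * C_L := mul_le_mul_of_nonneg_right ((sum_abs_h_le h E hsupp habs i).trans (hN i)) hC

/-- `wrs (L H_□) j ≤ wrs L j` when `|h_□| ≤ 1`. [folklore] -/
theorem wrs_mul_Hd_le (h : B → Y → ℝ) (habs : ∀ b y, |h b y| ≤ 1) (b : B) (A : Matrix Y Y ℂ) (j : Y) :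
    wrs κ d (A * Hd h b) j ≤ wrs κ d A j := by
  unfold wrs
  refine Finset.sum_le_sum fun l _ => ?_
  have hentry : (A * Hd h b) j l = A j l * (h b l : ℂ) := by simp [Hd, Matrix.mul_diagonal]
  rw [hentry, norm_mul, Complex.norm_real, Real.norm_eq_abs]
  have h1 : |h b l| ≤ 1 := habs b l
  have h0 : 0 ≤ ‖A j l‖ * Real.exp (κ * d j l) := by positivity
  nlinarith [abs_nonneg (h b l), norm_nonneg (A j l), Real.exp_pos (κ * d j l)]

/-- **Remainder bound** `WRS κ d R ((2N/M)·C_L·K₁)`: the commutator `[H_□, K′]` gains the Lipschitz factor `d(i,j)/M`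
(`comm_apply`), summed over the `≤ 2N` cubes seeing `i` or `j`; the local inverse costs `C_L` (submultiplicativity
`wrs_mul_le` BY NAME); `K₁` bounds the first exponential moment `Σ_j ‖K′(i,j)‖ d(i,j) e^{κd(i,j)}` of `K′`. [folklore] -/
theorem wrs_Rem [Fintype B] (hw : WeightHyp κ d) (K' : Matrix Y Y ℂ) (h : B → Y → ℝ) (E : B → Finset Y)
    (L : B → Matrix Y Y ℂ) (hsupp : ∀ b y, y ∉ E b → h b y = 0) (habs : ∀ b y, |h b y| ≤ 1) {M N C_L K₁ : ℝ}
    (hM : 0 < M) (hLip : ∀ b y y', |h b y - h b y'| ≤ d y y' / M)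
    (hN : ∀ y, ((Finset.univ.filter fun b => y ∈ E b).card : ℝ) ≤ N) (hC : 0 ≤ C_L)
    (hL : ∀ b, WRS κ d (L b) C_L) (hK₁ : ∀ i, ∑ j, ‖K' i j‖ * d i j * Real.exp (κ * d i j) ≤ K₁) :
    WRS κ d (Rem h K' L) (2 * N / M * C_L * K₁) := by
  intro i
  -- per cube: wrs((HK′ − K′H) L H) i ≤ Σ_j |h i − h j| ‖K′ i j‖ e^{κ d i j} C_L
  have hcube : ∀ b, wrs κ d ((Hd h b * K' - K' * Hd h b) * L b * Hd h b) i
      ≤ ∑ j, |h b i - h b j| * ‖K' i j‖ * Real.exp (κ * d i j) * C_L := by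
    intro b
    rw [mul_assoc]
    refine (wrs_mul_le hw _ _ i).trans (Finset.sum_le_sum fun j _ => ?_)
    have hA : ‖(Hd h b * K' - K' * Hd h b) i j‖ = |h b i - h b j| * ‖K' i j‖ := by
      rw [comm_apply, norm_mul, ← Complex.ofReal_sub, Complex.norm_real, Real.norm_eq_abs]
    have hB : wrs κ d (L b * Hd h b) j ≤ C_L := (wrs_mul_Hd_le h habs b (L b) j).trans (hL b j)
    rw [hA]
    have h0 : 0 ≤ |h b i - h b j| * ‖K' i j‖ * Real.exp (κ * d i j) := by positivity
    exact mul_le_mul_of_nonneg_left hB h0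
  calc wrs κ d (Rem h K' L) i
      ≤ ∑ b, wrs κ d ((Hd h b * K' - K' * Hd h b) * L b * Hd h b) i := wrs_sum_le _ _ i
    _ ≤ ∑ b, ∑ j, |h b i - h b j| * ‖K' i j‖ * Real.exp (κ * d i j) * C_L := Finset.sum_le_sum fun b _ => hcube b
    _ = ∑ j, (∑ b, |h b i - h b j|) * (‖K' i j‖ * Real.exp (κ * d i j) * C_L) := by
        rw [Finset.sum_comm]
        refine Finset.sum_congr rfl fun j _ => ?_
        rw [Finset.sum_mul]
        refine Finset.sum_congr rfl fun b _ => ?_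
        ring
    _ ≤ ∑ j, (2 * N * d i j / M) * (‖K' i j‖ * Real.exp (κ * d i j) * C_L) :=
        Finset.sum_le_sum fun j _ => mul_le_mul_of_nonneg_right
          (sum_abs_h_sub_le h E hsupp hM hLip hw.nonneg hN i j) (by positivity)
    _ = 2 * N / M * C_L * ∑ j, ‖K' i j‖ * d i j * Real.exp (κ * d i j) := by
        rw [Finset.mul_sum]
        refine Finset.sum_congr rfl fun j _ => ?_
        ring
    _ ≤ 2 * N / M * C_L * K₁ := by
        have hN0 : 0 ≤ N := le_trans (by positivity) (hN i)
        exact mul_le_mul_of_nonneg_left (hK₁ i) (by positivity)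

end Bounds

/-! ## §4 The inverse in the weighted-row-sum algebra and the walk expansion to every order -/

section Inverse

variable {κ : ℝ} {d : Y → Y → ℝ}

/-- **Invertibility and the inverse formula**: if `(1 + K′)·Ptot = 1 − R` and `WRS(R) ≤ ρ < 1`, then `1 + K′` is
invertible and `(1 + K′)⁻¹ = Ptot·(1 − R)⁻¹` (`B13PerturbativeStep.isUnit_one_sub` BY NAME; a right inverse of a square
matrix is its inverse). [folklore] -/
theorem inv_one_add_eq [Fintype B] (hw : WeightHyp κ d) {K' : Matrix Y Y ℂ} {h : B → Y → ℝ}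
    {L : B → Matrix Y Y ℂ} {ρ : ℝ} (hid : (1 + K') * Ptot h L = 1 - Rem h K' L)
    (hR : WRS κ d (Rem h K' L) ρ) (hρ : ρ < 1) :
    IsUnit (1 + K') ∧ (1 + K')⁻¹ = Ptot h L * (1 - Rem h K' L)⁻¹ := by
  have hU : IsUnit (1 - Rem h K' L) := isUnit_one_sub hw hR hρ
  have hdet : IsUnit (1 - Rem h K' L).det := (Matrix.isUnit_iff_isUnit_det _).1 hU
  have hright : (1 + K') * (Ptot h L * (1 - Rem h K' L)⁻¹) = 1 := by
    rw [← Matrix.mul_assoc, hid, Matrix.mul_nonsing_inv _ hdet]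
  refine ⟨(Matrix.isUnit_iff_isUnit_det _).2 (Matrix.isUnit_det_of_right_inverse hright), ?_⟩
  exact Matrix.inv_eq_right_inv hright

/-- **The inverse is a (2.16)-type kernel**: `WRS κ d (1 + K′)⁻¹ (C_P·(1 − ρ)⁻¹)` from `WRS(Ptot) ≤ C_P`, `WRS(R) ≤ ρ < 1`
(`WRS.mul`, `WRS.inv_one_sub` BY NAME). [folklore] -/
theorem wrs_inv_one_add [Fintype B] (hw : WeightHyp κ d) {K' : Matrix Y Y ℂ} {h : B → Y → ℝ}
    {L : B → Matrix Y Y ℂ} {ρ C_P : ℝ} (hid : (1 + K') * Ptot h L = 1 - Rem h K' L)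
    (hP : WRS κ d (Ptot h L) C_P) (hR : WRS κ d (Rem h K' L) ρ) (hρ : ρ < 1) :
    WRS κ d (1 + K')⁻¹ (C_P * (1 - ρ)⁻¹) := by
  rw [(inv_one_add_eq hw hid hR hρ).2]
  exact hP.mul hw (hR.inv_one_sub hw hρ)

/-- The Neumann identity to every order: `(1 − R)⁻¹ = Σ_{n<m} Rⁿ + R^m·(1 − R)⁻¹` (no topology; `inv_one_sub_eq` BY NAME,
iterated). [folklore] -/
theorem inv_one_sub_eq_sum_add (R : Matrix Y Y ℂ) (hU : IsUnit (1 - R)) (m : ℕ) :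
    (1 - R)⁻¹ = (∑ n ∈ Finset.range m, R ^ n) + R ^ m * (1 - R)⁻¹ := by
  induction m with
  | zero => simp
  | succ m ih =>
      rw [Finset.sum_range_succ, pow_succ, Matrix.mul_assoc]
      conv_lhs => rw [ih, inv_one_sub_eq R hU]
      rw [Matrix.mul_add, Matrix.mul_one]
      abel

/-- **THE WALK EXPANSION TO EVERY ORDER with a geometric remainder**: `(1 + K′)⁻¹ = Σ_{n<m} Ptot·Rⁿ + Ptot·R^m·(1 − R)⁻¹`
and `WRS(Ptot·R^m·(1 − R)⁻¹) ≤ C_P·ρ^m·(1 − ρ)⁻¹`.  The terms `Ptot·Rⁿ` are finite sums, over sequences of `n + 1` cubes,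
of products of the LOCAL factors `H_□`, `L_□`, `[H_□, K′]` — the generalized random walks of length `n`. [folklore] -/
theorem inv_one_add_eq_sum [Fintype B] (hw : WeightHyp κ d) {K' : Matrix Y Y ℂ} {h : B → Y → ℝ}
    {L : B → Matrix Y Y ℂ} {ρ C_P : ℝ} (hid : (1 + K') * Ptot h L = 1 - Rem h K' L)
    (hP : WRS κ d (Ptot h L) C_P) (hR : WRS κ d (Rem h K' L) ρ) (hρ : ρ < 1) (m : ℕ) :
    (1 + K')⁻¹ = (∑ n ∈ Finset.range m, Ptot h L * Rem h K' L ^ n)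
        + Ptot h L * Rem h K' L ^ m * (1 - Rem h K' L)⁻¹
      ∧ WRS κ d (Ptot h L * Rem h K' L ^ m * (1 - Rem h K' L)⁻¹) (C_P * ρ ^ m * (1 - ρ)⁻¹) := by
  refine ⟨?_, (hP.mul hw (hR.pow hw m)).mul hw (hR.inv_one_sub hw hρ)⟩
  have hN := inv_one_sub_eq_sum_add (Rem h K' L) (isUnit_one_sub hw hR hρ) m
  calc (1 + K')⁻¹ = Ptot h L * (1 - Rem h K' L)⁻¹ := (inv_one_add_eq hw hid hR hρ).2
    _ = Ptot h L * ((∑ n ∈ Finset.range m, Rem h K' L ^ n) + Rem h K' L ^ m * (1 - Rem h K' L)⁻¹) :=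
        congrArg (Ptot h L * ·) hN
    _ = (∑ n ∈ Finset.range m, Ptot h L * Rem h K' L ^ n)
        + Ptot h L * Rem h K' L ^ m * (1 - Rem h K' L)⁻¹ := by
        rw [Matrix.mul_add, Finset.mul_sum, Matrix.mul_assoc]

/-- **ASSEMBLY (the spine of A.3′)**: partition data `(h, □̃)` with `Σh² = 1`, supports, `|h| ≤ 1`, Lipschitz `1/M`,
overlap `N`; local inverses `L_□` with budget `C_L`; first exponential moment `K₁` of `K′`; smallness
`ρ := (2N/M)·C_L·K₁ < 1` («M sufficiently large» — for `K′ = xK` on `x ∈ [0, X]` read `K₁ = X·K₁(K)`: x-UNIFORM).  Then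
`1 + K′` is invertible, `(1 + K′)⁻¹ = Ptot·(1 − R)⁻¹`, and `WRS κ d (1 + K′)⁻¹ (N·C_L·(1 − ρ)⁻¹)`. [folklore] -/
theorem walkInversion [Fintype B] (hw : WeightHyp κ d) (K' : Matrix Y Y ℂ) (h : B → Y → ℝ) (E : B → Finset Y)
    (L : B → Matrix Y Y ℂ) (hsum : ∀ y, ∑ b, h b y ^ 2 = 1) (hsupp : ∀ b y, y ∉ E b → h b y = 0)
    (habs : ∀ b y, |h b y| ≤ 1) {M N C_L K₁ : ℝ} (hM : 0 < M) (hLip : ∀ b y y', |h b y - h b y'| ≤ d y y' / M)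
    (hN : ∀ y, ((Finset.univ.filter fun b => y ∈ E b).card : ℝ) ≤ N) (hC : 0 ≤ C_L)
    (hL : ∀ b, WRS κ d (L b) C_L) (hPL : ∀ b, Pj E b * L b = L b)
    (hinv : ∀ b, Pj E b * (1 + K') * Pj E b * L b = Pj E b)
    (hK₁ : ∀ i, ∑ j, ‖K' i j‖ * d i j * Real.exp (κ * d i j) ≤ K₁) (hρ : 2 * N / M * C_L * K₁ < 1) :
    IsUnit (1 + K') ∧ (1 + K')⁻¹ = Ptot h L * (1 - Rem h K' L)⁻¹
      ∧ WRS κ d (1 + K')⁻¹ (N * C_L * (1 - 2 * N / M * C_L * K₁)⁻¹) := by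
  have hid := resummation_identity K' h E L hsum hsupp hPL hinv
  have hR := wrs_Rem hw K' h E L hsupp habs hM hLip hN hC hL hK₁
  have hP := wrs_Ptot h E L hsupp habs hC hN hL
  exact ⟨(inv_one_add_eq hw hid hR hρ).1, (inv_one_add_eq hw hid hR hρ).2, wrs_inv_one_add hw hid hP hR hρ⟩

end Inverse

end

end Summit.QuantumFields.BalabanUV.Beta.UnitLatticeWalkInversion
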